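import Summits.Ventures.CertifiedManyBodySolver.Rows.HomTorusModel
import HarnessLib

/-!
# Hubbard tori generated by an additive lattice map (Part III: rows and the energy density)

HONEST FRAMING: first certified bounds; not a superconductivity verdict; every number certified or
labelled float. Part III of the kernel transport of NN-Hubbard window certificates to the torus
generated by an additive lattice map `φ : ℤ^d →+ (ℤ/Nℤ)^{d'}` (Part I: `HomTorusModel`): the row
lemmas of the window embedding `homEmb φ` (isotony, translation rows become symmetry defects
`U_{φ v} Y U_{φ v}ᴴ − Y`, the density `n_{0σ}`), the image of the Hubbard mean-energy observable
`E_Φ`, and the IDENTITY OF THE OBJECTIVE: for non-degenerate hops (`±φ(eᵢ)` pairwise distinct) the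
translates of `Γ(ι) E_Φ` over `(ℤ/Nℤ)^{d'}` sum to `homHubbard φ t U` (every bond `{x, x ± φ(eᵢ)}` is
counted twice with weight `½`). Line-by-line the tree's `HubbardWindowCertificate` §Window and
`InfVolFermionStateHubbardEnergy` §TorusImage with `x ↦ x mod L` replaced by `φ`.
[cite: Han2020Bootstrap, §2–3] [cite: BratteliRobinsonII1997, §5.2.2, §6.2.4]
-/

noncomputable section

open Matrix Finset
open Literature.MathematicalPhysics.QuantumLattice
open Literature.MathematicalPhysics.QuantumFieldTheory hiding Site
open Literature.MathematicalPhysics.QuantumManyBody.StateRelaxation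
open Literature.Probability.LatticeModels
open HubbardWave0
open scoped ComplexOrder ComplexConjugate

namespace Summit.Ventures.CertifiedManyBodySolver.Rows

section EnergyDensity

variable {d d' N : ℕ} [NeZero N] (φ : Site d →+ TorusSite d' N) (t U : ℝ)

/-- **Isotony then pull-back = pull-back of the smaller region**: `Γ(ι_{Λ'}) (Γ(incl) Z) = Γ(ι_S) Z`
for `S ⊆ Λ'` (functoriality of `Γ`). [cite: BratteliRobinsonII1997, §5.2.2] -/
theorem fermionEmbed_homEmb_incl {S Λ' : Finset (Site d)} (hS : S ⊆ Λ')
    (hInj' : Set.InjOn φ ↑Λ') (Z : FermionOp S) :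
    fermionEmbed (homEmb φ hInj') (fermionEmbed (PolySite.incl hS) Z) =
      fermionEmbed (homEmb φ (hInj'.mono (by exact_mod_cast hS))) Z := by
  rw [fermionEmbed_fermionEmbed]
  exact congrFun (congrArg DFunLike.coe (fermionEmbed_congr fun p => rfl)) Z

/-- **Pulling a translated region back into the torus is the torus translate of the pull-back**:
`Γ(ι_{Λ+v,L}) (Γ(τ_v) A) = T_{v mod L} (Γ(ι_{Λ,L}) A)` with `T_w = relabel (Orb.translate w)`
(functoriality of `Γ` and `Γ(bijection) = relabel`). [folklore] -/
theorem fermionEmbed_homEmb_shiftEmb (v : Site d) {Λ : Finset (Site d)}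
    (h : Set.InjOn φ ↑Λ) (h' : Set.InjOn φ ↑(shiftSet v Λ))
    (A : FermionOp Λ) :
    fermionEmbed (homEmb φ h') (fermionEmbed (PolySite.shiftEmb v Λ) A) =
      relabel (Orb.translate (φ v)) (fermionEmbed (homEmb φ h) A) := by
  have key : (PolySite.shiftEmb v Λ).trans (homEmb φ h') =
      (homEmb φ h).trans
        (FermionTorus.ofTorusEquiv (Equiv.addRight (φ v))).toEmbedding := by
    refine DFunLike.ext _ _ fun y => ?_
    rw [Function.Embedding.trans_apply, Function.Embedding.trans_apply, homEmb_apply,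
      homEmb_apply, Equiv.coe_toEmbedding, FermionTorus.ofTorusEquiv_apply,
      FermionTorus.toTorusSite_ofTorusSite, Equiv.coe_addRight, PolySite.ofLex_coe_shiftEmb, map_add]
  rw [fermionEmbed_fermionEmbed, key, ← fermionEmbed_fermionEmbed, fermionEmbed_equiv]
  rfl

/-- **Translation differences in the window become symmetry defects on the torus**:
`Γ(ι_{Λ'})(Γ(incl)(Γ(τ_v) Y) − Γ(incl) Y) = U_{v mod L} (Γ(ι_Λ) Y) U_{v mod L}ᴴ − Γ(ι_Λ) Y`.
Han 2020 §2 eq. (2) (`F[U⁻¹ O U] = F[O]` for lattice translations `U`).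
[cite: Han2020Bootstrap, §2 eq. (2)] -/
theorem fermionEmbed_homEmb_shift_sub {Λ Λ' : Finset (Site d)} (hΛ : Λ ⊆ Λ') (v : Site d)
    (hsh : shiftSet v Λ ⊆ Λ') (hInj' : Set.InjOn φ ↑Λ') (Y : FermionOp Λ) :
    fermionEmbed (homEmb φ hInj')
        (fermionEmbed (PolySite.incl hsh) (fermionEmbed (PolySite.shiftEmb v Λ) Y) -
          fermionEmbed (PolySite.incl hΛ) Y) =
      (fockTranslate (φ v)).val *
          fermionEmbed (homEmb φ (hInj'.mono (by exact_mod_cast hΛ))) Y *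
          (fockTranslate (φ v)).valᴴ -
        fermionEmbed (homEmb φ (hInj'.mono (by exact_mod_cast hΛ))) Y := by
  rw [fermionEmbed_sub, fermionEmbed_homEmb_incl φ hsh hInj', fermionEmbed_homEmb_incl φ hΛ hInj',
    fermionEmbed_homEmb_shiftEmb φ v (hInj'.mono (by exact_mod_cast hΛ)) (hInj'.mono (by exact_mod_cast hsh)) Y,
    relabel_eq_fockRelabel_conj]

/-- The pulled-back density `Γ(ι)(n_{0σ})` is the torus number operator at the origin. [folklore] -/
theorem fermionEmbed_homEmb_nAt_zero {Λ' : Finset (Site d)} (hz : (0 : Site d) ∈ Λ')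
    (hInj' : Set.InjOn φ ↑Λ') (σ : Fin 2) :
    fermionEmbed (homEmb φ hInj') (nAt 0 hz σ) =
      numberOp (FermionTorus.ofTorusSite (0 : TorusSite d' N)) σ := by
  rw [nAt, fermionEmbed_numberOp, homEmb_pt, map_zero]

/-- **`E_Φ` in the torus**: for `L ≥ 3`, the second quantisation `Γ(ι)` of `[-1,1]^d ↪ (ℤ/Lℤ)^d`
maps the mean-energy observable of the Hubbard interaction to
`U n_{0↑}n_{0↓} + Σ_i ½·(-t) Σ_σ (c†_0 c_{e_i} + c†_{e_i} c_0 + (c†_{-e_i} c_0 + c†_0 c_{-e_i}))`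
(torus sites `ofTorusSite 0`, `ofTorusSite (±φ (unitVec i))`). [folklore] -/
theorem fermionEmbed_homEmb_hubbard_meanEnergyObs (hT : Set.InjOn φ
      ↑(thicken ({0} : Finset (Site d)) 1)) :
    fermionEmbed (homEmb φ hT) ((hubbardFermionInteraction d t U).meanEnergyObs 1) =
      (U : ℂ) • (numberOp (FermionTorus.ofTorusSite (0 : TorusSite d' N)) 0 *
          numberOp (FermionTorus.ofTorusSite (0 : TorusSite d' N)) 1) +
        ∑ i : Fin d, ((2 : ℂ)⁻¹ * -(t : ℂ)) • ∑ σ : Fin 2,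
          ((creation (orb (FermionTorus.ofTorusSite (0 : TorusSite d' N)) σ) *
              annihilation (orb (FermionTorus.ofTorusSite (φ (unitVec i))) σ) +
            creation (orb (FermionTorus.ofTorusSite (φ (unitVec i))) σ) *
              annihilation (orb (FermionTorus.ofTorusSite (0 : TorusSite d' N)) σ)) +
          (creation (orb (FermionTorus.ofTorusSite (-φ (unitVec i))) σ) *
              annihilation (orb (FermionTorus.ofTorusSite (0 : TorusSite d' N)) σ) +
            creation (orb (FermionTorus.ofTorusSite (0 : TorusSite d' N)) σ) *
              annihilation (orb (FermionTorus.ofTorusSite (-φ (unitVec i))) σ))) := by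
  -- images of the generators under `Γ(ι ∘ incl)`
  have hc : ∀ {X : Finset (Site d)} (hX : X ⊆ thicken ({0} : Finset (Site d)) 1) (x : Site d) (hx : x ∈ X)
      (σ : Fin 2),
      fermionEmbed ((PolySite.incl hX).trans (homEmb φ hT)) (cAt x hx σ) =
        annihilation (orb (FermionTorus.ofTorusSite (φ x)) σ) := by
    intro X hX x hx σ
    rw [cAt, fermionEmbed_annihilation]
    rfl
  have hcd : ∀ {X : Finset (Site d)} (hX : X ⊆ thicken ({0} : Finset (Site d)) 1) (x : Site d) (hx : x ∈ X)
      (σ : Fin 2),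
      fermionEmbed ((PolySite.incl hX).trans (homEmb φ hT)) ((cAt x hx σ)ᴴ) =
        creation (orb (FermionTorus.ofTorusSite (φ x)) σ) := by
    intro X hX x hx σ
    rw [cAt, annihilation_conjTranspose, fermionEmbed_creation]
    rfl
  have hn : ∀ {X : Finset (Site d)} (hX : X ⊆ thicken ({0} : Finset (Site d)) 1) (x : Site d) (hx : x ∈ X)
      (σ : Fin 2),
      fermionEmbed ((PolySite.incl hX).trans (homEmb φ hT)) (nAt x hx σ) =
        numberOp (FermionTorus.ofTorusSite (φ x)) σ := by
    intro X hX x hx σ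
    rw [nAt, fermionEmbed_numberOp]
    rfl
  rw [hubbardFermionInteraction_meanEnergyObs, fermionEmbed_add, fermionEmbed_sum, fermionEmbed_fermionEmbed,
    hubbardFermionInteraction_apply_singleton, fermionEmbed_smul, fermionEmbed_mul, hn, hn, map_zero]
  congr 1
  refine Finset.sum_congr rfl fun i _ => ?_
  rw [fermionEmbed_add, fermionEmbed_smul, fermionEmbed_smul, fermionEmbed_fermionEmbed, fermionEmbed_fermionEmbed,
    hubbardFermionInteraction_apply_pair, hubbardFermionInteraction_apply_pair, fermionEmbed_smul, fermionEmbed_smul,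
    fermionEmbed_sum, fermionEmbed_sum, smul_smul, smul_smul, ← smul_add, ← Finset.sum_add_distrib]
  congr 1
  refine Finset.sum_congr rfl fun σ _ => ?_
  rw [fermionEmbed_add, fermionEmbed_add, fermionEmbed_mul, fermionEmbed_mul, fermionEmbed_mul, fermionEmbed_mul,
    hc, hc, hc, hc, hcd, hcd, hcd, hcd, zero_add, neg_add_cancel, map_zero, map_neg]

/-- **The translates of `E_Φ` sum to the torus Hamiltonian.** For `L ≥ 3`:
`Σ_{v ∈ (ℤ/Lℤ)^d} T_v (Γ(ι) E_Φ) T_v⁻¹ = homHubbard φ t U`, where `T_v = relabel (Orb.translate v)`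
is the translation automorphism (every on-site term appears once; every bond `{x, x ± e_i}` of the
torus is a bond through `v` for exactly its two endpoints, each with weight `½`). Bratteli–Robinson
II §6.2.4 (periodic boundary conditions). [folklore] -/
theorem sum_relabel_translate_homEmb_meanEnergyObs
    (hT : Set.InjOn φ ↑(thicken ({0} : Finset (Site d)) 1)) (hdist : Function.Injective (signedHop φ)) :
    ∑ v : TorusSite d' N, relabel (Orb.translate v)
        (fermionEmbed (homEmb φ hT)
          ((hubbardFermionInteraction d t U).meanEnergyObs 1)) =
      homHubbard φ t U := by
  -- abbreviations for the torus operators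
  set o : TorusSite d' N → FermionTorus d' N := FermionTorus.ofTorusSite with ho
  set cd : TorusSite d' N → Fin 2 → Matrix (Finset (Orb (FermionTorus d' N))) (Finset (Orb (FermionTorus d' N))) ℂ :=
    fun x σ => creation (orb (o x) σ) with hcd
  set c : TorusSite d' N → Fin 2 → Matrix (Finset (Orb (FermionTorus d' N))) (Finset (Orb (FermionTorus d' N))) ℂ :=
    fun x σ => annihilation (orb (o x) σ) with hc
  set nn : TorusSite d' N → Matrix (Finset (Orb (FermionTorus d' N))) (Finset (Orb (FermionTorus d' N))) ℂ :=
    fun x => numberOp (o x) 0 * numberOp (o x) 1 with hnn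
  -- the translate by `v` of `Γ(ι) E_Φ`
  have hcomm : ∀ (w : TorusSite d' N) (i : Fin d), (φ (unitVec i)) + w = w + φ (unitVec i) :=
    fun w i => add_comm _ _
  have htrans : ∀ v : TorusSite d' N, relabel (Orb.translate v)
      (fermionEmbed (homEmb φ hT)
        ((hubbardFermionInteraction d t U).meanEnergyObs 1)) =
      (U : ℂ) • nn v + ∑ i : Fin d, ((2 : ℂ)⁻¹ * -(t : ℂ)) • ∑ σ : Fin 2,
        ((cd v σ * c (v + φ (unitVec i)) σ + cd (v + φ (unitVec i)) σ * c v σ) +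
          (cd (v - φ (unitVec i)) σ * c v σ + cd v σ * c (v - φ (unitVec i)) σ)) := by
    intro v
    rw [fermionEmbed_homEmb_hubbard_meanEnergyObs φ t U hT, relabel_add, relabel_smul,
      relabel_mul, Orb.translate, relabel_mapEquiv_numberOp, relabel_mapEquiv_numberOp, relabel_sum]
    simp only [relabel_smul, relabel_sum, relabel_add, relabel_mul, relabel_creation, relabel_annihilation,
      Orb.mapEquiv_orb, FermionTorus.ofTorusEquiv_ofTorusSite, Equiv.coe_addRight, zero_add, neg_add_eq_sub, hcomm]
    rfl
  simp_rw [htrans]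
  rw [Finset.sum_add_distrib, ← Finset.smul_sum, Finset.sum_comm]
  -- the Hamiltonian, with all sums over `TorusSite`
  have hH : homHubbard φ t U =
      -(t : ℂ) • (∑ v : TorusSite d' N, ∑ i : Fin d, ∑ σ : Fin 2,
          (cd v σ * c (v + φ (unitVec i)) σ + cd v σ * c (v - φ (unitVec i)) σ)) +
        (U : ℂ) • ∑ v : TorusSite d' N, nn v := by
    rw [homHubbard, hamiltonian]
    congr 1
    · congr 1
      rw [← Fintype.sum_equiv FermionTorus.equivTorusSite.symm
        (fun v : TorusSite d' N => ∑ i : Fin d, ∑ σ : Fin 2,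
          (cd v σ * c (v + φ (unitVec i)) σ + cd v σ * c (v - φ (unitVec i)) σ)) _ (fun v => ?_)]
      rw [← Fintype.sum_equiv FermionTorus.equivTorusSite.symm
        (fun w : TorusSite d' N => ∑ σ : Fin 2,
          if (homTorusGraph φ).Adj (FermionTorus.equivTorusSite.symm v) (o w) then
            creation (orb (FermionTorus.equivTorusSite.symm v) σ) * annihilation (orb (o w) σ) else 0)
        _ (fun w => rfl)]
      have hv : (FermionTorus.equivTorusSite.symm v : FermionTorus d' N) = o v := rfl
      simp_rw [hv]
      have hadj : ∀ w : TorusSite d' N, (homTorusGraph φ).Adj (o v) (o w) ↔ (homSiteGraph φ).Adj v w := by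
        intro w; rw [ho]; exact homTorusGraph_adj_ofTorusSite φ v w
      have hite : ∀ w : TorusSite d' N, (∑ σ : Fin 2,
          if (homTorusGraph φ).Adj (o v) (o w) then creation (orb (o v) σ) * annihilation (orb (o w) σ) else 0) =
          if (homSiteGraph φ).Adj v w then ∑ σ : Fin 2, cd v σ * c w σ else 0 := by
        intro w
        by_cases h : (homSiteGraph φ).Adj v w
        · rw [if_pos h]
          exact Finset.sum_congr rfl fun σ _ => by rw [if_pos ((hadj _).2 h)]
        · rw [if_neg h]
          exact Finset.sum_eq_zero fun σ _ => by rw [if_neg (fun h' => h ((hadj _).1 h'))]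
      simp_rw [hite]
      rw [sum_ite_homSiteGraph_adj φ hdist v]
      simp only [Finset.sum_add_distrib]
    · congr 1
      exact (Fintype.sum_equiv FermionTorus.equivTorusSite.symm (fun v => nn v)
        (fun x : FermionTorus d' N => numberOp x 0 * numberOp x 1) fun v => rfl).symm
  rw [hH, add_comm]
  congr 1
  -- the hopping part: each bond is counted twice with weight ½
  simp only [Finset.smul_sum]
  conv_rhs => rw [Finset.sum_comm]
  refine Finset.sum_congr rfl fun i _ => ?_
  have hshift1 : ∑ v : TorusSite d' N, ∑ σ : Fin 2, ((2 : ℂ)⁻¹ * -(t : ℂ)) • (cd (v + φ (unitVec i)) σ * c v σ) =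
      ∑ v : TorusSite d' N, ∑ σ : Fin 2, ((2 : ℂ)⁻¹ * -(t : ℂ)) • (cd v σ * c (v - φ (unitVec i)) σ) :=
    (TorusSite.sum_sub_shift (φ (unitVec i))
      (fun a b => ∑ σ : Fin 2, ((2 : ℂ)⁻¹ * -(t : ℂ)) • (cd a σ * c b σ))).symm
  have hshift2 : ∑ v : TorusSite d' N, ∑ σ : Fin 2, ((2 : ℂ)⁻¹ * -(t : ℂ)) • (cd (v - φ (unitVec i)) σ * c v σ) =
      ∑ v : TorusSite d' N, ∑ σ : Fin 2, ((2 : ℂ)⁻¹ * -(t : ℂ)) • (cd v σ * c (v + φ (unitVec i)) σ) :=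
    TorusSite.sum_sub_shift (φ (unitVec i))
      (fun a b => ∑ σ : Fin 2, ((2 : ℂ)⁻¹ * -(t : ℂ)) • (cd b σ * c a σ))
  simp only [smul_add, Finset.sum_add_distrib]
  rw [hshift1, hshift2]
  have ha : ((2 : ℂ)⁻¹ * -(t : ℂ)) + ((2 : ℂ)⁻¹ * -(t : ℂ)) = -(t : ℂ) := by ring
  simp only [← Finset.smul_sum]
  conv_rhs => rw [← ha, add_smul, add_smul]
  abel

end EnergyDensity

end Summit.Ventures.CertifiedManyBodySolver.Rows

end
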